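import Mathlib
import HarnessLib

/-!
# Stubs `helper_logTransform`, `helper_logTransform_le` of line `Sketch`
(crux `EntropyRung.ConicalGap`, stmt-SmoothPoincare4-16589)

PURE REAL ANALYSIS. On a gradient shrinking Ricci soliton the finite density transform
(Wang–Wang 2023) reads `H(1) = H(T) + ∫₁ᵀ (τ − 1) τ⁻⁴ N(τ) dτ` for every `T ≥ 1`, with `H > 0` on
`[1, ∞)` and `H, N` continuous on `(0, ∞)`. Here we integrate the underlying ODE
`H' = −(τ − 1) τ⁻⁴ N` in logarithmic form,

  `log H(1) = log H(T) + ∫₁ᵀ (τ − 1) τ⁻⁴ N(τ) / H(τ) dτ`     (`helper_logTransform`),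

by showing that `Ψ(u) = log H(u) + ∫₁ᵘ (τ − 1) τ⁻⁴ N / H` is continuous on `[1, T]` with vanishing
right derivative (one-sided FTC-1 + `constant_of_has_deriv_right_zero`). Under the cone bound
`N ≤ σ τ H` (and `N ≥ 0`) the integrand is at most `σ (τ − 1) τ⁻³`, whose integral over `[1, T]` is
`(σ/2) (1 − T⁻¹)²`; exponentiating gives

  `H(1) ≤ H(T) · exp ((σ/2) (1 − T⁻¹)²)`     (`helper_logTransform_le`).

Everything here is proved from Mathlib; no definition and no named fact is introduced.

## References

* Y. Wang, G. Wang (Wang–Wang 2023), arXiv:2308.06560, Prop. 2.6.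
-/

noncomputable section

-- `Summit.SmoothPoincare4.SmoothPoincare4.…` (summit = problem) trips `dupNamespace` on every decl.
set_option linter.dupNamespace false

open MeasureTheory Set Filter
open scoped Topology

namespace Summit.SmoothPoincare4.SmoothPoincare4.Theorems.ConicalGapSketch

/-! ## One-sided FTC and continuity of the integrands -/

/-- FTC-1, one-sided: for `g` continuous on `[1, ∞)` and `x ≥ 1`, the primitive `u ↦ ∫₁ᵘ g` has
right derivative `g x` at `x`. -/
theorem logTransform_primitive_hasDerivWithinAt {g : ℝ → ℝ} (hg : ContinuousOn g (Ici 1))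
    {x : ℝ} (hx : 1 ≤ x) :
    HasDerivWithinAt (fun u ↦ ∫ t in (1 : ℝ)..u, g t) (g x) (Ici x) x := by
  have hint : IntervalIntegrable g volume 1 x := by
    refine (hg.mono ?_).intervalIntegrable
    rw [uIcc_of_le hx]
    exact Icc_subset_Ici_self
  have hsub : Ioi x ⊆ Ici 1 := fun u hu ↦ hx.trans (le_of_lt hu)
  have hmeas : StronglyMeasurableAtFilter g (𝓝[>] x) volume :=
    (hg.mono hsub).stronglyMeasurableAtFilter_nhdsWithin measurableSet_Ioi x
  have hcont : ContinuousWithinAt g (Ioi x) x := (hg x hx).mono hsub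
  exact intervalIntegral.integral_hasDerivWithinAt_right hint hmeas hcont

/-- The transform integrand `τ ↦ (τ − 1) τ⁻⁴ N(τ)` is continuous on `[1, ∞)` when `N` is
continuous on `(0, ∞)`. -/
theorem logTransform_integrand_continuousOn {N : ℝ → ℝ} (hN : ContinuousOn N (Ioi 0)) :
    ContinuousOn (fun τ : ℝ ↦ (τ - 1) / τ ^ 4 * N τ) (Ici 1) := by
  refine continuousOn_of_forall_continuousAt fun τ hτ ↦ ?_
  have hτ0 : 0 < τ := one_pos.trans_le hτ
  have hNτ : ContinuousAt N τ := hN.continuousAt (Ioi_mem_nhds hτ0)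
  fun_prop (disch := positivity)

/-- The elementary integral `∫₁ᵀ σ (τ − 1) τ⁻³ dτ = (σ/2) (1 − T⁻¹)²` for `T ≥ 1`
(antiderivative `(σ/2) (1 − τ⁻¹)²`). -/
theorem logTransform_kernel_integral (σ : ℝ) {T : ℝ} (hT : 1 ≤ T) :
    ∫ τ in (1 : ℝ)..T, σ * ((τ - 1) / τ ^ 3) = σ / 2 * (1 - T⁻¹) ^ 2 := by
  have hcont : ContinuousOn (fun τ : ℝ ↦ σ * ((τ - 1) / τ ^ 3)) (uIcc 1 T) := by
    rw [uIcc_of_le hT]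
    refine continuousOn_of_forall_continuousAt fun τ hτ ↦ ?_
    have hτ0 : 0 < τ := one_pos.trans_le hτ.1
    fun_prop (disch := positivity)
  have hderiv : ∀ τ ∈ uIcc (1 : ℝ) T,
      HasDerivAt (fun s : ℝ ↦ σ / 2 * (1 - s⁻¹) ^ 2) (σ * ((τ - 1) / τ ^ 3)) τ := fun τ hτ ↦ by
    rw [uIcc_of_le hT] at hτ
    have hτ0 : τ ≠ 0 := (one_pos.trans_le hτ.1).ne'
    refine ((((hasDerivAt_inv hτ0).const_sub 1).fun_pow 2).const_mul (σ / 2)).congr_deriv ?_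
    have h2 : ((2 : ℕ) : ℝ) * (1 - τ⁻¹) ^ (2 - 1) = 2 * (1 - τ⁻¹) := by norm_num
    rw [h2]
    field_simp
  rw [intervalIntegral.integral_eq_sub_of_hasDerivAt hderiv hcont.intervalIntegrable]
  simp

/-! ## The registered stubs -/

/-- **Stub `helper_logTransform` of line `Sketch`**: integrating the Wang–Wang ODE exactly. If
`H, N` are continuous on `(0, ∞)`, `H > 0` on `[1, ∞)` and `H(1) = H(T) + ∫₁ᵀ (τ − 1) τ⁻⁴ N(τ) dτ`
for every `T ≥ 1`, then `log H(1) = log H(T) + ∫₁ᵀ (τ − 1) τ⁻⁴ N(τ) / H(τ) dτ` for every `T ≥ 1`. -/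
theorem helper_logTransform : ∀ (H N : ℝ → ℝ), ContinuousOn H (Set.Ioi 0) → ContinuousOn N (Set.Ioi 0) → (∀ T : ℝ, 1 ≤ T → 0 < H T) → (∀ T : ℝ, 1 ≤ T → H 1 = H T + ∫ τ in (1 : ℝ)..T, (τ - 1) / τ ^ 4 * N τ) → ∀ T : ℝ, 1 ≤ T → Real.log (H 1) = Real.log (H T) + ∫ τ in (1 : ℝ)..T, (τ - 1) / τ ^ 4 * N τ / H τ := by
  intro H N hH hN hpos htrans T hT
  have hsub : Ici (1 : ℝ) ⊆ Ioi 0 := Ici_subset_Ioi.2 one_pos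
  have hH1 : ContinuousOn H (Ici 1) := hH.mono hsub
  have hφ := logTransform_integrand_continuousOn hN
  have hψ : ContinuousOn (fun τ : ℝ ↦ (τ - 1) / τ ^ 4 * N τ / H τ) (Ici 1) :=
    hφ.div₀ hH1 fun τ hτ ↦ (hpos τ hτ).ne'
  -- right derivative of `H` from the transform identity
  have hHd : ∀ x : ℝ, 1 ≤ x → HasDerivWithinAt H (-((x - 1) / x ^ 4 * N x)) (Ici x) x := by
    intro x hx
    have h := (hasDerivWithinAt_const x (Ici x) (H 1)).fun_sub
      (logTransform_primitive_hasDerivWithinAt hφ hx)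
    refine (h.congr_of_mem (fun u hu ↦ ?_) (mem_Ici.2 le_rfl)).congr_deriv (zero_sub _)
    have := htrans u (hx.trans hu)
    linarith
  -- the right derivative of `Ψ = log H + ∫₁ (τ − 1) τ⁻⁴ N / H` vanishes on `[1, ∞)`
  have hΨd : ∀ x : ℝ, 1 ≤ x → HasDerivWithinAt
      (fun u ↦ Real.log (H u) + ∫ τ in (1 : ℝ)..u, (τ - 1) / τ ^ 4 * N τ / H τ) 0 (Ici x) x := by
    intro x hx
    refine (((hHd x hx).log (hpos x hx).ne').fun_add
      (logTransform_primitive_hasDerivWithinAt hψ hx)).congr_deriv ?_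
    ring
  -- continuity of `Ψ` on `[1, T]`
  have hΨc : ContinuousOn
      (fun u ↦ Real.log (H u) + ∫ τ in (1 : ℝ)..u, (τ - 1) / τ ^ 4 * N τ / H τ) (Icc 1 T) := by
    have hI : IntegrableOn (fun τ : ℝ ↦ (τ - 1) / τ ^ 4 * N τ / H τ) (uIcc 1 T) volume := by
      rw [uIcc_of_le hT]
      exact (hψ.mono Icc_subset_Ici_self).integrableOn_Icc
    have h2 := intervalIntegral.continuousOn_primitive_interval hI
    rw [uIcc_of_le hT] at h2
    exact ((hH1.log fun τ hτ ↦ (hpos τ hτ).ne').mono Icc_subset_Ici_self).fun_add h2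
  have key := constant_of_has_deriv_right_zero hΨc (fun x hx ↦ hΨd x hx.1) T
    (right_mem_Icc.2 hT)
  simp only [intervalIntegral.integral_same, add_zero] at key
  exact key.symm

/-- **Stub `helper_logTransform_le` of line `Sketch`**: the half-sup bound. Under the hypotheses
of `helper_logTransform` together with `N ≥ 0` and the cone bound `N(T) ≤ σ T H(T)` on `[1, ∞)`,
one has `H(1) ≤ H(T) · exp ((σ/2) (1 − T⁻¹)²)` for every `T ≥ 1`: the log-integrand is at most
`σ (τ − 1) τ⁻³` (this uses only `H > 0` and the cone bound; the hypothesis `N ≥ 0` of the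
registered signature is not needed), and `∫₁ᵀ σ (τ − 1) τ⁻³ dτ = (σ/2) (1 − T⁻¹)²`. -/
theorem helper_logTransform_le : ∀ (H N : ℝ → ℝ) (σ : ℝ), ContinuousOn H (Set.Ioi 0) → ContinuousOn N (Set.Ioi 0) → (∀ T : ℝ, 1 ≤ T → 0 < H T) → (∀ T : ℝ, 1 ≤ T → 0 ≤ N T) → (∀ T : ℝ, 1 ≤ T → H 1 = H T + ∫ τ in (1 : ℝ)..T, (τ - 1) / τ ^ 4 * N τ) → (∀ T : ℝ, 1 ≤ T → N T ≤ σ * (T * H T)) → ∀ T : ℝ, 1 ≤ T → H 1 ≤ H T * Real.exp (σ / 2 * (1 - T⁻¹) ^ 2) := by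
  intro H N σ hH hN hpos _hN0 htrans hcone T hT
  have hlog := helper_logTransform H N hH hN hpos htrans T hT
  have hsub : Ici (1 : ℝ) ⊆ Ioi 0 := Ici_subset_Ioi.2 one_pos
  have hψ : ContinuousOn (fun τ : ℝ ↦ (τ - 1) / τ ^ 4 * N τ / H τ) (Ici 1) :=
    (logTransform_integrand_continuousOn hN).div₀ (hH.mono hsub) fun τ hτ ↦ (hpos τ hτ).ne'
  have hk : ContinuousOn (fun τ : ℝ ↦ σ * ((τ - 1) / τ ^ 3)) (Icc 1 T) := by
    refine continuousOn_of_forall_continuousAt fun τ hτ ↦ ?_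
    have hτ0 : 0 < τ := one_pos.trans_le hτ.1
    fun_prop (disch := positivity)
  -- pointwise bound on the log-integrand
  have hle : ∀ τ ∈ Icc (1 : ℝ) T, (τ - 1) / τ ^ 4 * N τ / H τ ≤ σ * ((τ - 1) / τ ^ 3) := by
    intro τ hτ
    have hτ0 : 0 < τ := one_pos.trans_le hτ.1
    have hHτ : 0 < H τ := hpos τ hτ.1
    have hc : 0 ≤ (τ - 1) / τ ^ 4 / H τ :=
      div_nonneg (div_nonneg (sub_nonneg.2 hτ.1) (by positivity)) hHτ.le
    calc (τ - 1) / τ ^ 4 * N τ / H τ = (τ - 1) / τ ^ 4 / H τ * N τ := by ring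
      _ ≤ (τ - 1) / τ ^ 4 / H τ * (σ * (τ * H τ)) :=
        mul_le_mul_of_nonneg_left (hcone τ hτ.1) hc
      _ = σ * ((τ - 1) / τ ^ 3) := by
        field_simp
  -- integrate the bound
  have hI : ∫ τ in (1 : ℝ)..T, (τ - 1) / τ ^ 4 * N τ / H τ ≤ σ / 2 * (1 - T⁻¹) ^ 2 := by
    rw [← logTransform_kernel_integral σ hT]
    refine intervalIntegral.integral_mono_on hT ?_ ?_ hle
    · refine (hψ.mono ?_).intervalIntegrable
      rw [uIcc_of_le hT]
      exact Icc_subset_Ici_self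
    · refine (hk.mono ?_).intervalIntegrable
      rw [uIcc_of_le hT]
  -- exponentiate
  calc H 1 = Real.exp (Real.log (H 1)) := (Real.exp_log (hpos 1 le_rfl)).symm
    _ ≤ Real.exp (Real.log (H T) + σ / 2 * (1 - T⁻¹) ^ 2) := Real.exp_le_exp.2 (by linarith)
    _ = H T * Real.exp (σ / 2 * (1 - T⁻¹) ^ 2) := by
      rw [Real.exp_add, Real.exp_log (hpos T hT)]

end Summit.SmoothPoincare4.SmoothPoincare4.Theorems.ConicalGapSketch

end
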